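import Mathlib.Analysis.Convex.SpecificFunctions.Deriv
import Mathlib.Analysis.Convex.Deriv
import Literature.MathematicalPhysics.QuantumFieldTheory.Balaban1983to89.B10StarCount
import HarnessLib

/-!
# Line «covariant_discharge» on crux `HistoryTailL` (stmt-QuantumFields-19936) — the NO-GAIN LEMMA: on a uniform abelian flux, undoing ANY
# bounded-support sweep does not lower the Wilson action (kernel face of the LEAD's located hazard «(HGap) is blind to locally uniform excess»)

Cell `ym3-torus` (YM ladder rung R3 = continuum SU(2) Yang–Mills on the three-torus — a RUNG, NOT the Clay problem), width seat
`ym-ust-19936-w3` gen 8, on LEAD ★w1-19936 g6's «(N-1) GO» (cell bus 2026-08-28T18:47:44Z).  The sweep-gap hypothesis (HGap) of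
`CovariantDischargeSweepGapReduction.unboundedDepth_of_sweepGap` (✓) asks, per plaquette and direction, for ONE `dU`-preserving bijection `Ψ′`
with `β_K·(A(V) − A(Ψ′V)) ≥ c_g·p² − D > 0` for EVERY `V` in the window.  The LEAD's witness: an abelian-along-`n̂` configuration whose fine
plaquette flux is the CONSTANT `F₀` on a region containing the support of the sweep's amplitude 1-form `a` (it lies in the window and meets the
direction conjunct).  For it `A(V) − A(Ψ′V) = Σ_p [cos(F₀ − (da)_p) − cos F₀]`, and THIS FILE proves that this is `≤ 0`:

* §1 `cos_le_cos_add_sin_mul` — the tangent-line inequality of the CONCAVE cosine on `[−π/2, π/2]`: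
  `cos x ≤ cos y + sin y·(y − x)`; hence ★`sum_cos_sub_cos_le_zero`: `Σᵢ (cos(F₀ − dᵢ) − cos F₀) ≤ sin F₀ · Σᵢ dᵢ`, `= 0` when `Σᵢ dᵢ = 0`
  (`|F₀|, |F₀ − dᵢ| ≤ π/2`) — Jensen; no third-order bookkeeping.
* §2 ★`sum_circulation_eq_zero` — on each torus `T^{(j)}` of the cell and for each orientation `(μ, ν)`, the circulations
  `a⟨x,μ⟩ + a⟨x+e_μ,ν⟩ − a⟨x+e_ν,μ⟩ − a⟨x,ν⟩` of ANY bond function `a` sum to zero over the base points `x` (translation by `e_μ`, `e_ν` is a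
  bijection of the torus, lit `B10StarCount.shiftEquiv`): every exact lattice 2-form has zero total flux per orientation — so §1 applies to every
  sweep, bounded support or not.

CONSEQUENCE (the LEAD's census, card v1.17 (c)): no V-independent (or covariantly framed) sweep inhabits (HGap); (HGap) is not thereby FALSE (it
quantifies over arbitrary measurable bijections) but has no constructive content; `stub_unboundedDepth` is organ-class.  WHAT THIS IS NOT: the
embedding of the witness into Bałaban's block averages is the LEAD's memo `HAZARD-HGap-uniform-w1g6.md`, not typed here; nothing of the stubs, the
crux, the rung R3, d = 4 or a mass gap is proved or refuted.  YM₃ on T³ is rung R3, NOT Clay.  Folklore.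
-/

noncomputable section

open Real Set

namespace Summit.QuantumFields.YangMills.Theorems.CovariantDischargeSweepNoGain

/-! ## §1 Jensen for the cosine on `[−π/2, π/2]` -/

/-- **TANGENT-LINE INEQUALITY FOR THE CONCAVE COSINE**: for `x, y ∈ [−π/2, π/2]`, `cos x ≤ cos y + sin y·(y − x)` (cos lies below its
tangent at `y`; Mathlib `strictConcaveOn_cos_Icc` + the secant/derivative comparison). [folklore] -/
theorem cos_le_cos_add_sin_mul {x y : ℝ} (hx : |x| ≤ π / 2) (hy : |y| ≤ π / 2) :
    Real.cos x ≤ Real.cos y + Real.sin y * (y - x) := by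
  have hconc : ConcaveOn ℝ (Icc (-(π / 2)) (π / 2)) Real.cos := strictConcaveOn_cos_Icc.concaveOn
  have hxI : x ∈ Icc (-(π / 2)) (π / 2) := ⟨(abs_le.mp hx).1, (abs_le.mp hx).2⟩
  have hyI : y ∈ Icc (-(π / 2)) (π / 2) := ⟨(abs_le.mp hy).1, (abs_le.mp hy).2⟩
  have hder : HasDerivAt Real.cos (-Real.sin y) y := Real.hasDerivAt_cos y
  rcases lt_trichotomy x y with hlt | heq | hgt
  · -- `x < y`: the derivative at the right endpoint is below the secant slope
    have h := hconc.le_slope_of_hasDerivAt hxI hyI hlt hder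
    rw [slope_def_field] at h
    have hpos : 0 < y - x := sub_pos.mpr hlt
    have h' : -Real.sin y * (y - x) ≤ Real.cos y - Real.cos x := (le_div_iff₀ hpos).mp h
    linarith
  · subst heq; simp
  · -- `y < x`: the secant slope is below the derivative at the left endpoint
    have h := hconc.slope_le_of_hasDerivAt hyI hxI hgt hder
    rw [slope_def_field] at h
    have hpos : 0 < x - y := sub_pos.mpr hgt
    have h' : Real.cos x - Real.cos y ≤ -Real.sin y * (x - y) := (div_le_iff₀ hpos).mp h
    linarith

/-- The same read at `x = F₀ − d`: `cos(F₀ − d) − cos F₀ ≤ sin F₀ · d`. [folklore] -/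
theorem cos_sub_sub_cos_le {F₀ d : ℝ} (hF : |F₀| ≤ π / 2) (hd : |F₀ - d| ≤ π / 2) :
    Real.cos (F₀ - d) - Real.cos F₀ ≤ Real.sin F₀ * d := by
  have h := cos_le_cos_add_sin_mul hd hF
  have e : F₀ - (F₀ - d) = d := by ring
  rw [e] at h
  linarith

/-- **NO GAIN ON A UNIFORM FLUX** (Jensen): `Σᵢ (cos(F₀ − dᵢ) − cos F₀) ≤ sin F₀ · Σᵢ dᵢ` for `|F₀| ≤ π/2`, `|F₀ − dᵢ| ≤ π/2`. [folklore] -/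
theorem sum_cos_sub_cos_le {ι : Type*} (s : Finset ι) {F₀ : ℝ} {d : ι → ℝ} (hF : |F₀| ≤ π / 2)
    (hd : ∀ i ∈ s, |F₀ - d i| ≤ π / 2) :
    ∑ i ∈ s, (Real.cos (F₀ - d i) - Real.cos F₀) ≤ Real.sin F₀ * ∑ i ∈ s, d i := by
  rw [Finset.mul_sum]
  exact Finset.sum_le_sum fun i hi => cos_sub_sub_cos_le hF (hd i hi)

/-- **… hence `≤ 0` when the perturbation has zero total flux** (`Σᵢ dᵢ = 0`): undoing the sweep does not lower the abelian Wilson action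
`Σ_p (1 − cos F_p)` of a uniform configuration — the action DROP `A(V) − A(Ψ′V) = Σ_p [cos(F₀ − (da)_p) − cos F₀]` is non-positive, never the
positive gap `(c_g·p² − D)/β_K` of (HGap). [folklore] -/
theorem sum_cos_sub_cos_le_zero {ι : Type*} (s : Finset ι) {F₀ : ℝ} {d : ι → ℝ} (hF : |F₀| ≤ π / 2)
    (hd : ∀ i ∈ s, |F₀ - d i| ≤ π / 2) (hsum : ∑ i ∈ s, d i = 0) :
    ∑ i ∈ s, (Real.cos (F₀ - d i) - Real.cos F₀) ≤ 0 := by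
  have h := sum_cos_sub_cos_le s hF hd
  rwa [hsum, mul_zero] at h

/-- Equivalently, in action currency: `Σ_p (1 − cos F₀) ≤ Σ_p (1 − cos(F₀ − d_p))` — the perturbed uniform configuration has at least the
action of the uniform one. [folklore] -/
theorem sum_one_sub_cos_le_sum_one_sub_cos_sub {ι : Type*} (s : Finset ι) {F₀ : ℝ} {d : ι → ℝ} (hF : |F₀| ≤ π / 2)
    (hd : ∀ i ∈ s, |F₀ - d i| ≤ π / 2) (hsum : ∑ i ∈ s, d i = 0) :
    ∑ _i ∈ s, (1 - Real.cos F₀) ≤ ∑ i ∈ s, (1 - Real.cos (F₀ - d i)) := by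
  have h := sum_cos_sub_cos_le_zero s hF hd hsum
  rw [Finset.sum_sub_distrib] at h
  rw [Finset.sum_sub_distrib, Finset.sum_sub_distrib]
  linarith

/-! ## §2 Exact lattice 2-forms have zero total flux per orientation (the cell's tori) -/

section Torus

open Literature.MathematicalPhysics.QuantumFieldTheory.Balaban1983to89
open Literature.MathematicalPhysics.QuantumFieldTheory.Balaban1983to89.B10StarCount (shiftEquiv)

variable {P : Params} {j : ℕ} {M : Type*} [AddCommGroup M]

/-- Translating the base point by `e_κ` does not change a sum over the torus `T^{(j)}`. [folklore] -/
theorem sum_shift_eq (κ : Fin P.d) (f : Site P j → M) : ∑ x : Site P j, f (x.shift κ) = ∑ x : Site P j, f x :=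
  Equiv.sum_comp (shiftEquiv (P := P) (i := j) κ) f

/-- **ZERO TOTAL CIRCULATION**: for ANY bond function `a` on the torus `T^{(j)}` and any orientation `(μ, ν)`, the circulations of `a` around
the plaquettes `⟨x, x+e_μ, x+e_μ+e_ν, x+e_ν⟩` — in the letters `b₁ = ⟨x,μ⟩, b₂ = ⟨x+e_μ,ν⟩, b₃ = ⟨x+e_ν,μ⟩, b₄ = ⟨x,ν⟩` of `GaugeField.plaqHol` —
sum to zero over the base points: `Σ_x [a⟨x,μ⟩ + a⟨x+e_μ,ν⟩ − a⟨x+e_ν,μ⟩ − a⟨x,ν⟩] = 0` (each bond enters twice with opposite signs,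
translation being a bijection of the torus). [folklore] -/
theorem sum_circulation_eq_zero (a : PBond P j → M) (μ ν : Fin P.d) :
    ∑ x : Site P j, (a ⟨x, μ⟩ + a ⟨x.shift μ, ν⟩ - a ⟨x.shift ν, μ⟩ - a ⟨x, ν⟩) = 0 := by
  simp only [Finset.sum_sub_distrib, Finset.sum_add_distrib]
  rw [sum_shift_eq μ (fun x => a ⟨x, ν⟩), sum_shift_eq ν (fun x => a ⟨x, μ⟩)]
  abel

/-- **THE WITNESS'S INEQUALITY ASSEMBLED** on a torus of the cell: for a bond function `a : PBond → ℝ`, an orientation `(μ, ν)` and a uniform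
flux `F₀` with `|F₀| ≤ π/2` and `|F₀ − (da)_x| ≤ π/2` for all base points, the abelian action change over that orientation is non-positive:
`Σ_x [cos(F₀ − (da)_x) − cos F₀] ≤ 0`. [folklore] -/
theorem sum_cos_sub_circulation_le_zero (a : PBond P j → ℝ) (μ ν : Fin P.d) {F₀ : ℝ} (hF : |F₀| ≤ π / 2)
    (hd : ∀ x : Site P j, |F₀ - (a ⟨x, μ⟩ + a ⟨x.shift μ, ν⟩ - a ⟨x.shift ν, μ⟩ - a ⟨x, ν⟩)| ≤ π / 2) :
    ∑ x : Site P j, (Real.cos (F₀ - (a ⟨x, μ⟩ + a ⟨x.shift μ, ν⟩ - a ⟨x.shift ν, μ⟩ - a ⟨x, ν⟩)) - Real.cos F₀) ≤ 0 :=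
  sum_cos_sub_cos_le_zero Finset.univ hF (fun x _ => hd x) (sum_circulation_eq_zero a μ ν)

end Torus

end Summit.QuantumFields.YangMills.Theorems.CovariantDischargeSweepNoGain

end
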